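import Literature.Analysis.FluidPDE.MollifiedNSRTripleLocal
import Literature.Analysis.FluidPDE.BVEnergyStageTools
import HarnessLib

/-!
# The energy stage of Buckmaster–Vicol (Ann. of Math. 189 (2019), §7), III: the final
  re-mollification and gluing (the `C¹` bound (2.4) of the new stress)

Analysis/FluidPDE support file (everything proved). After the weighted jet step the new stress
`R'` is controlled in `L¹` and in sup norm but not in `C¹`. `EnergyPump.final_glue` mollifies
the jetted triple `(v', p', R')` at a much finer scale `ℓ₂` (`exists_mollified_nsr_package_local`,
whose stress `R'_c + M̊'` is controlled in `C¹` with losses `ℓ₂⁻¹`) and glues it back to `(v', p', R')`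
with the SAME time cut-off `θ` as in the preparation (`θ = 0` on the small-gap zone, where
`(v', R') = (v, 0)` is untouched and must stay so for (2.6)'; `θ = 1` on the pump zone). The `C¹`
bound of the glued stress is obtained zone-wise from the weighted bounds
`Torus.norm_partialDeriv_glueStress_le_weighted` / `norm_timeDerivWithin_glueStress_le_weighted`:
where `θ = 1` the weight of `R'` vanishes, where `θ < 1` the gap is `< δ/4`, the pump is off near
`t` and `R' = R_cb` there, whose `C¹` size is known. The energy profile of the result is within
`η₂ = O(ℓ₂)` of that of `v'`, which gives (2.5)' and (2.6)' at the next level from the zone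
structure of the gaps.

## References

* T. Buckmaster, V. Vicol, Ann. of Math. 189 (2019) = arXiv:1709.10033, Prop. 2.1, §7. [`BuckmasterVicol2019Annals`]
-/

noncomputable section

open MeasureTheory Set Filter Topology Function
open scoped InnerProductSpace ContDiff ENNReal NNReal

namespace Literature.Analysis.FluidPDE

namespace EnergyPump

open Literature.Analysis.FunctionSpaces FunctionSpaces.Torus Literature.Analysis.Calculus


set_option maxHeartbeats 6000000 in
/-- **Final re-mollification and gluing of the energy stage** (see the module docstring).
[cite: BuckmasterVicol2019Annals, Prop. 2.1, §7] -/
theorem final_glue : ∃ C : ℝ, 1 ≤ C ∧ ∃ K : ℝ, 0 ≤ K ∧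
    ∀ (T ν : ℝ) (e : ℝ → ℝ) (v vb v' : ℝ → (UnitAddTorus (Fin 3)) → (EuclideanSpace ℝ (Fin 3))) (p' : ℝ → (UnitAddTorus (Fin 3)) → ℝ) (Rcb R' : ℝ → (UnitAddTorus (Fin 3)) → Fin 3 → (EuclideanSpace ℝ (Fin 3))) (θ Gm : ℝ → ℝ)
      (W₀ W₁ W₂ S₀ L₁ Θ₁ Θ₂ Sb₁ Sb₂ δ η εE ℓ₂ : ℝ),
    0 < T → Torus.IsNSReynoldsOn (Icc 0 T) ν v' p' R' → (∀ t ∈ Icc 0 T, HasZeroMean (v' t)) →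
    FunctionSpaces.Torus.IsSmoothSpaceTimeOn (Icc 0 T) v → FunctionSpaces.Torus.IsSmoothSpaceTimeOn (Icc 0 T) vb →
    -- the cut-off
    ContDiffOn ℝ ∞ θ (Icc 0 T) → (∀ t, 0 ≤ θ t ∧ θ t ≤ 1) →
    (∀ t ∈ Icc 0 T, |derivWithin θ (Icc 0 T) t| ≤ Θ₁) → (∀ t ∈ Icc 0 T, |derivWithin (derivWithin θ (Icc 0 T)) (Icc 0 T) t| ≤ Θ₂) →
    (∀ t ∈ Icc 0 T, (θ t = 0 ∨ θ t = 1) → derivWithin θ (Icc 0 T) t = 0 ∧ derivWithin (derivWithin θ (Icc 0 T)) (Icc 0 T) t = 0) →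
    (∀ t, θ t ≠ 1 → Gm t < δ / 4) → (∀ t, θ t ≠ 0 → δ / 8 < Gm t) →
    ContinuousOn Gm (Icc 0 T) →
    -- the zones
    (∀ t ∈ Icc 0 T, Gm t ≤ 3 * δ / 8 → v' t = vb t ∧ R' t = Rcb t) →
    (∀ t ∈ Icc 0 T, Gm t < 3 * δ / 8 → ∀ y l, ‖Torus.partialDeriv l (Rcb t) y‖ ≤ Sb₁ ∧ ‖Torus.timeDerivWithin (Icc 0 T) Rcb t y‖ ≤ Sb₂) →
    0 ≤ Sb₁ → 0 ≤ Sb₂ →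
    (∀ t ∈ Icc 0 T, Gm t ≤ δ / 8 → v' t = v t ∧ R' t = 0) →
    -- sizes of the jetted triple
    1 ≤ W₀ → 0 ≤ W₁ → 0 ≤ W₂ → 0 ≤ S₀ → 0 ≤ L₁ →
    (∀ t ∈ Icc 0 T, ∀ y, ‖v' t y‖ ≤ W₀) → (∀ i, ∀ t ∈ Icc 0 T, ∀ y, ‖Torus.partialDeriv i (v' t) y‖ ≤ W₁) →
    (∀ t ∈ Icc 0 T, ∀ y, ‖Torus.timeDerivWithin (Icc 0 T) v' t y‖ ≤ W₂) →
    (∀ t ∈ Icc 0 T, ∀ y, ‖R' t y‖ ≤ S₀) → (∀ t ∈ Icc 0 T, ∫ y, ‖R' t y‖ ≤ L₁) →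
    -- the gaps (`G = e - ∫|v|²`, `G_b = e - ∫|v_b|²`, `G' = e - ∫|v'|²`)
    0 < δ → (∀ t ∈ Icc 0 T, 0 ≤ e t - ∫ y, ‖v t y‖ ^ 2) →
    (∀ t ∈ Icc 0 T, |(e t - ∫ y, ‖v t y‖ ^ 2) - Gm t| ≤ η) → (∀ t ∈ Icc 0 T, |(e t - ∫ y, ‖vb t y‖ ^ 2) - Gm t| ≤ η) →
    (∀ t ∈ Icc 0 T, |(e t - ∫ y, ‖v' t y‖ ^ 2) - ((e t - ∫ y, ‖vb t y‖ ^ 2) - pumpProfile δ (Gm t) ^ 2)| ≤ εE) →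
    -- the fine scale and the smallness condition
    0 < ℓ₂ → ℓ₂ ≤ 1 / 4 → 8 * ℓ₂ ≤ T →
    η + εE + (2 * (C * W₀) + C * (W₂ + W₁) * ℓ₂) * (C * (W₂ + W₁) * ℓ₂) ≤ δ / 10 →
    ∃ (vn : ℝ → (UnitAddTorus (Fin 3)) → (EuclideanSpace ℝ (Fin 3))) (pn : ℝ → (UnitAddTorus (Fin 3)) → ℝ) (Rn : ℝ → (UnitAddTorus (Fin 3)) → Fin 3 → (EuclideanSpace ℝ (Fin 3))) (D₂ ρ₂ S₁ : ℝ),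
      D₂ = C * (W₂ + W₁) * ℓ₂ ∧ ρ₂ = C * (W₀ + 1 / T) * (W₂ + W₁) * ℓ₂ ∧
      S₁ = (C * W₀ * (W₀ * ℓ₂⁻¹ + (W₂ + W₁)) + K * (C * (1 / T) * W₀ * ℓ₂⁻¹)) + 4 * (C * S₀ * ℓ₂⁻¹) ∧
      Torus.IsNSReynoldsOn (Icc 0 T) ν vn pn Rn ∧ (∀ t ∈ Icc 0 T, HasZeroMean (vn t)) ∧
      (∀ t ∈ Icc 0 T, ∀ y, ‖vn t y‖ ≤ C * W₀) ∧
      (∀ i, ∀ t ∈ Icc 0 T, ∀ y, ‖Torus.partialDeriv i (vn t) y‖ ≤ C * (W₂ + W₁) + W₁) ∧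
      (∀ t ∈ Icc 0 T, ∀ y, ‖Torus.timeDerivWithin (Icc 0 T) vn t y‖ ≤ (C * (W₂ + W₁) + W₂) + Θ₁ * D₂) ∧
      (∀ t ∈ Icc 0 T, ∀ y, ‖vn t y - v' t y‖ ≤ D₂) ∧
      (∀ t ∈ Icc 0 T, ∀ y, ‖Rn t y‖ ≤ S₀ + (ρ₂ + 2 * (C * S₀)) + D₂ ^ 2 / 2 + K * (Θ₁ * D₂)) ∧
      (∀ t ∈ Icc 0 T, ∫ y, ‖Rn t y‖ ≤ L₁ + (ρ₂ + 2 * (C * L₁)) + D₂ ^ 2 / 2 + K * (Θ₁ * D₂)) ∧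
      (∀ t ∈ Icc 0 T, ∀ y l, ‖Torus.partialDeriv l (Rn t) y‖ ≤ Sb₁ + S₁ + D₂ * (C * (W₂ + W₁) + W₁) + K * (Θ₁ * (C * (W₂ + W₁) + W₁))) ∧
      (∀ t ∈ Icc 0 T, ∀ y, ‖Torus.timeDerivWithin (Icc 0 T) Rn t y‖ ≤
        Θ₁ * (S₀ + (ρ₂ + 2 * (C * S₀))) + Sb₂ + S₁ + 2 * Θ₁ * D₂ ^ 2 + D₂ * (C * (W₂ + W₁) + W₂) +
          K * (Θ₂ * D₂ + Θ₁ * (C * (W₂ + W₁) + W₂))) ∧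
      (∀ t ∈ Icc 0 T, 0 ≤ e t - ∫ y, ‖vn t y‖ ^ 2 ∧ e t - ∫ y, ‖vn t y‖ ^ 2 ≤ δ) ∧
      (∀ t ∈ Icc 0 T, e t - ∫ y, ‖vn t y‖ ^ 2 ≤ δ / 100 → ∀ x, Rn t x = 0) := by
  obtain ⟨C, hC1, hpkg⟩ := Torus.exists_mollified_nsr_package_local (d := Fin 3) (by simp)
  obtain ⟨K, hK0, hK⟩ := Torus.exists_norm_antidivergence_le (d := Fin 3) (by simp)
  refine ⟨C, hC1, K, hK0, ?_⟩
  intro T ν e v vb v' p' Rcb R' θ Gm W₀ W₁ W₂ S₀ L₁ Θ₁ Θ₂ Sb₁ Sb₂ δ η εE ℓ₂ hT hns' hmean' hvS hvbS hθs hθ01 hθ' hθ'' hθflat hθne1 hθne0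
    hGmc hagree hquiet hSb₁ hSb₂ huntouched hW₀ hW₁ hW₂ hS₀ hL₁ hv0 hv1 hvt hR0 hRL1 hδ hGpos hGGm hGbGm hG'E hℓ hℓ4 hℓT hsmall
  have hC0 : 0 ≤ C := by linarith
  have hW₀0 : 0 ≤ W₀ := by linarith
  have hU : UniqueDiffOn ℝ (Icc (0:ℝ) T) := uniqueDiffOn_Icc hT
  have h0T : (0:ℝ) ∈ Icc 0 T := ⟨le_rfl, hT.le⟩
  have hΘ₁0 : 0 ≤ Θ₁ := (abs_nonneg _).trans (hθ' 0 h0T)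
  have hΘ₂0 : 0 ≤ Θ₂ := (abs_nonneg _).trans (hθ'' 0 h0T)
  have hη0 : 0 ≤ η := (abs_nonneg _).trans (hGGm 0 h0T)
  have hεE0 : 0 ≤ εE := (abs_nonneg _).trans (hG'E 0 h0T)
  have hv'S : FunctionSpaces.Torus.IsSmoothSpaceTimeOn (Icc 0 T) v' := hns'.smooth_velocity
  have hR'S : FunctionSpaces.Torus.IsSmoothSpaceTimeOn (Icc 0 T) R' := hns'.smooth_stress
  -- ### Step 1: mollification at scale `ℓ₂`
  obtain ⟨vm, pm, Rc, Rcm, M, Rdef, hold, hvmmean, hRcS, hMS, hMsym, hRcsym, hvm0, hvmv, hvm1, hvmt, hRcb, hMδ, hMA, hM1, hM2,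
    hMt, hMt1, -, hRcdef, hRcmS, hRdefS, -, hRcm0, hRdef0, hRcm1, hRcmt, hRdef1, hRdeft, -, -⟩ :=
    hpkg T ν v' p' R' hns' hT hmean' W₀ W₁ W₂ S₀ L₁ ℓ₂ hv0 hv1 hvt hW₁ hW₂ hR0 hRL1 hℓ hℓ4 hℓT
  have hvmS : FunctionSpaces.Torus.IsSmoothSpaceTimeOn (Icc 0 T) vm := hold.smooth_velocity
  set R₁ : ℝ → (UnitAddTorus (Fin 3)) → Fin 3 → (EuclideanSpace ℝ (Fin 3)) := fun t x j => Rc t x j + Torus.traceless (M t) x j with hR₁def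
  have hR₁S : FunctionSpaces.Torus.IsSmoothSpaceTimeOn (Icc 0 T) R₁ := hold.smooth_stress
  -- the derived sizes
  set D₂ : ℝ := C * (W₂ + W₁) * ℓ₂ with hD₂
  set ρ₂ : ℝ := C * (W₀ + 1 / T) * (W₂ + W₁) * ℓ₂ with hρ₂
  set Sc : ℝ := C * W₀ * (W₀ * ℓ₂⁻¹ + (W₂ + W₁)) + K * (C * (1 / T) * W₀ * ℓ₂⁻¹) with hSc
  set S₁ : ℝ := Sc + 4 * (C * S₀ * ℓ₂⁻¹) with hS₁
  set η₂ : ℝ := (2 * (C * W₀) + D₂) * D₂ with hη₂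
  have hD₂0 : 0 ≤ D₂ := by positivity
  have hρ₂0 : 0 ≤ ρ₂ := by positivity
  have hsmall' : η + εE + η₂ ≤ δ / 10 := hsmall
  have hη₂0 : 0 ≤ η₂ := by positivity
  -- ### Step 2: the glued triple
  have hglue := hns'.glue hold hT hθs (by simp) hmean' hvmmean
  set vn := Torus.glueVel θ v' vm with hvndef
  set pn := Torus.gluePres θ v' vm p' pm with hpndef
  set Rn := Torus.glueStress T θ v' vm R' R₁ with hRndef
  have hRnS : FunctionSpaces.Torus.IsSmoothSpaceTimeOn (Icc 0 T) Rn := hglue.smooth_stress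
  have hdiff : ∀ t ∈ Icc 0 T, ∀ y, ‖Torus.glueDiff v' vm t y‖ ≤ D₂ := fun t ht y => hvmv t ht y
  have hdiff1 : ∀ t ∈ Icc 0 T, ∀ y l, ‖Torus.partialDeriv l (Torus.glueDiff v' vm t) y‖ ≤ C * (W₂ + W₁) + W₁ := by
    intro t ht y l
    have e1 : Torus.partialDeriv l (Torus.glueDiff v' vm t) y = Torus.partialDeriv l (vm t) y - Torus.partialDeriv l (v' t) y :=
      Torus.partialDeriv_sub_at ((hvmS.isSmooth_slice ht).isContDiff (by simp)) ((hv'S.isSmooth_slice ht).isContDiff (by simp)) l y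
    rw [e1]; exact (norm_sub_le _ _).trans (add_le_add (hvm1 t ht y l) (hv1 l t ht y))
  have hdifft : ∀ t ∈ Icc 0 T, ∀ y, ‖Torus.timeDerivWithin (Icc 0 T) (Torus.glueDiff v' vm) t y‖ ≤ C * (W₂ + W₁) + W₂ := by
    intro t ht y
    have e1 : Torus.timeDerivWithin (Icc 0 T) (Torus.glueDiff v' vm) t y = Torus.timeDerivWithin (Icc 0 T) vm t y - Torus.timeDerivWithin (Icc 0 T) v' t y := by
      show derivWithin (fun s => vm s y - v' s y) (Icc 0 T) t = _
      exact derivWithin_sub (hvmS.hasDerivWithinAt_slice ht y).differentiableWithinAt (hv'S.hasDerivWithinAt_slice ht y).differentiableWithinAt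
    rw [e1]; exact (norm_sub_le _ _).trans (add_le_add (hvmt t ht y) (hvt t ht y))
  -- zero mean
  have hvnmean : ∀ t ∈ Icc 0 T, HasZeroMean (vn t) := by
    intro t ht
    show ∫ y, vn t y = 0
    have e1 : vn t = fun y => (1 - θ t) • v' t y + θ t • vm t y := rfl
    have i1 : Integrable (fun y => (1 - θ t) • v' t y) volume := ((hv'S.isSmooth_slice ht).continuous.const_smul (1 - θ t)).integrable_unitAddTorus
    have i2 : Integrable (fun y => θ t • vm t y) volume := ((hvmS.isSmooth_slice ht).continuous.const_smul (θ t)).integrable_unitAddTorus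
    rw [e1, integral_add i1 i2, integral_smul, integral_smul, show ∫ y, v' t y = 0 from hmean' t ht, show ∫ y, vm t y = 0 from hvmmean t ht]
    simp
  -- ### Step 3: velocity bounds
  have hWCW : W₀ ≤ C * W₀ := by nlinarith
  have hCW12 : 0 ≤ C * (W₂ + W₁) := by positivity
  have hvn0 : ∀ t ∈ Icc 0 T, ∀ y, ‖vn t y‖ ≤ C * W₀ := fun t ht y =>
    Torus.norm_glueVel_le (hθ01 t).1 (hθ01 t).2 ((hv0 t ht y).trans hWCW) (hvm0 t y)
  have hvn1 : ∀ i, ∀ t ∈ Icc 0 T, ∀ y, ‖Torus.partialDeriv i (vn t) y‖ ≤ C * (W₂ + W₁) + W₁ := fun i t ht y =>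
    Torus.norm_partialDeriv_glueVel_le hns' hold ht (hθ01 t).1 (hθ01 t).2 i ((hv1 i t ht y).trans (by linarith))
      ((hvm1 t ht y i).trans (by linarith))
  have hvnt : ∀ t ∈ Icc 0 T, ∀ y, ‖Torus.timeDerivWithin (Icc 0 T) vn t y‖ ≤ (C * (W₂ + W₁) + W₂) + Θ₁ * D₂ := by
    intro t ht y
    have h1 := Torus.norm_timeDerivWithin_glueVel_le hns' hold hT hθs ht (hθ01 t).1 (hθ01 t).2 (B := C * (W₂ + W₁) + W₂) (y := y)
      ((hvt t ht y).trans (by linarith)) ((hvmt t ht y).trans (by linarith))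
    refine h1.trans (add_le_add le_rfl ?_)
    exact mul_le_mul (hθ' t ht) (hdiff t ht y) (norm_nonneg _) hΘ₁0
  have hvnv : ∀ t ∈ Icc 0 T, ∀ y, ‖vn t y - v' t y‖ ≤ D₂ := fun t ht y =>
    (Torus.norm_glueVel_sub_le (hθ01 t).1 (hθ01 t).2 y).trans (hdiff t ht y)
  -- ### Step 4: the stress `R₁ = R'_c + M̊'` and its sizes
  have hR₁0 : ∀ t ∈ Icc 0 T, ∀ y, ‖R₁ t y‖ ≤ ρ₂ + 2 * (C * S₀) := by
    intro t ht y
    have e1 : R₁ t y = Rc t y + Torus.traceless (M t) y := by funext j; simp [hR₁def]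
    rw [e1]
    refine (norm_add_le _ _).trans (add_le_add (hRcb t ht y) ?_)
    exact (Torus.norm_traceless_le (M t) y).trans (mul_le_mul_of_nonneg_left (hMA t y) (by norm_num))
  have hR₁L1 : ∀ t ∈ Icc 0 T, ∫ y, ‖R₁ t y‖ ≤ ρ₂ + 2 * (C * L₁) := by
    intro t ht
    have cRc : Continuous fun y => ‖Rc t y‖ := ((hRcS.isSmooth_slice ht).continuous).norm
    have cM : Continuous fun y => ‖M t y‖ := ((hMS.isSmooth_slice ht).continuous).norm
    have cR₁ : Continuous fun y => ‖R₁ t y‖ := ((hR₁S.isSmooth_slice ht).continuous).norm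
    have i1 : Integrable (fun y => ‖Rc t y‖ + 2 * ‖M t y‖) volume := (cRc.add (cM.const_mul 2)).integrable_unitAddTorus
    calc ∫ y, ‖R₁ t y‖ ≤ ∫ y, (‖Rc t y‖ + 2 * ‖M t y‖) := by
          refine integral_mono cR₁.integrable_unitAddTorus i1 fun y => ?_
          have e1 : R₁ t y = Rc t y + Torus.traceless (M t) y := by funext j; simp [hR₁def]
          show ‖R₁ t y‖ ≤ ‖Rc t y‖ + 2 * ‖M t y‖
          rw [e1]; exact (norm_add_le _ _).trans (add_le_add le_rfl (Torus.norm_traceless_le (M t) y))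
      _ = (∫ y, ‖Rc t y‖) + 2 * ∫ y, ‖M t y‖ := by
          rw [integral_add cRc.integrable_unitAddTorus ((cM.const_mul 2).integrable_unitAddTorus), integral_const_mul]
      _ ≤ ρ₂ + 2 * (C * L₁) := by
          refine add_le_add ?_ (mul_le_mul_of_nonneg_left (hMδ t) (by norm_num))
          calc ∫ y, ‖Rc t y‖ ≤ ∫ _y : (UnitAddTorus (Fin 3)), ρ₂ := integral_mono cRc.integrable_unitAddTorus (integrable_const _) fun y => hRcb t ht y
            _ = ρ₂ := by simp
  have hRc1 : ∀ t ∈ Icc 0 T, ∀ y l, ‖Torus.partialDeriv l (Rc t) y‖ ≤ Sc := by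
    intro t ht y l
    have hRcmt : IsSmooth (Rcm t) := hRcmS.isSmooth_slice ht
    have hRdeft : IsSmooth (Rdef t) := hRdefS.isSmooth_slice ht
    have e1 : Rc t = fun y j => Rcm t y j + Torus.antidivergence (Rdef t) y j := by funext y j; exact hRcdef t y j
    have e2 : Torus.partialDeriv l (Rc t) y = Torus.partialDeriv l (Rcm t) y + Torus.partialDeriv l (Torus.antidivergence (Rdef t)) y := by
      rw [e1]
      exact ((hRcmt.hasDerivAt_line_zero l y).add ((Torus.isSmooth_antidivergence hRdeft).hasDerivAt_line_zero l y)).deriv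
    rw [e2]
    refine (norm_add_le _ _).trans (add_le_add (hRcm1 t ht y l) ?_)
    exact Torus.norm_partialDeriv_antidivergence_le hK hRdeft l (by positivity) (fun x => hRdef1 t ht x l) y
  have hRct : ∀ t ∈ Icc 0 T, ∀ y, ‖Torus.timeDerivWithin (Icc 0 T) Rc t y‖ ≤ Sc := by
    intro t ht y
    have e1 : Rc = fun t y j => Rcm t y j + Torus.antidivergence (Rdef t) y j := by funext t y j; exact hRcdef t y j
    have e2 : Torus.timeDerivWithin (Icc 0 T) Rc t y = Torus.timeDerivWithin (Icc 0 T) Rcm t y +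
        Torus.timeDerivWithin (Icc 0 T) (fun s => Torus.antidivergence (Rdef s)) t y := by
      rw [e1]
      show derivWithin (fun s => (fun j => Rcm s y j + Torus.antidivergence (Rdef s) y j)) (Icc 0 T) t = _
      have k1 := hRcmS.hasDerivWithinAt_slice ht y
      have k2 := (hRdefS.antidivergence (convex_Icc 0 T) (by rw [interior_Icc]; exact nonempty_Ioo.2 hT)).hasDerivWithinAt_slice ht y
      exact (k1.add k2).derivWithin (hU t ht)
    rw [e2]
    refine (norm_add_le _ _).trans (add_le_add (hRcmt t ht y) ?_)
    exact Torus.norm_timeDerivWithin_antidivergence_le hK hT hRdefS ht (by positivity) (fun x => hRdeft t ht x) y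
  have hR₁1 : ∀ t ∈ Icc 0 T, ∀ y l, ‖Torus.partialDeriv l (R₁ t) y‖ ≤ S₁ := by
    intro t ht y l
    have hRct' : IsSmooth (Rc t) := hRcS.isSmooth_slice ht
    have hMt' : IsSmooth (M t) := hMS.isSmooth_slice ht
    have e1 : R₁ t = fun y j => Rc t y j + Torus.traceless (M t) y j := rfl
    have e2 : Torus.partialDeriv l (R₁ t) y = Torus.partialDeriv l (Rc t) y + Torus.partialDeriv l (Torus.traceless (M t)) y := by
      rw [e1]; exact ((hRct'.hasDerivAt_line_zero l y).add (hMt'.traceless.hasDerivAt_line_zero l y)).deriv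
    rw [e2]
    refine (norm_add_le _ _).trans (add_le_add (hRc1 t ht y l) ?_)
    refine (norm_partialDeriv_traceless_le hMt' l y).trans ?_
    have := hM1 t y l
    have h4 : (Fintype.card (Fin 3) + 1 : ℝ) = 4 := by norm_num
    rw [h4]; exact mul_le_mul_of_nonneg_left this (by norm_num)
  have hR₁t : ∀ t ∈ Icc 0 T, ∀ y, ‖Torus.timeDerivWithin (Icc 0 T) R₁ t y‖ ≤ S₁ := by
    intro t ht y
    have e2 : Torus.timeDerivWithin (Icc 0 T) R₁ t y = Torus.timeDerivWithin (Icc 0 T) Rc t y +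
        Torus.timeDerivWithin (Icc 0 T) (fun s => Torus.traceless (M s)) t y := by
      show derivWithin (fun s => (fun j => Rc s y j + Torus.traceless (M s) y j)) (Icc 0 T) t = _
      have k1 := hRcS.hasDerivWithinAt_slice ht y
      have k2 := hMS.traceless.hasDerivWithinAt_slice ht y
      exact (k1.add k2).derivWithin (hU t ht)
    rw [e2]
    refine (norm_add_le _ _).trans (add_le_add (hRct t ht y) ?_)
    refine (norm_timeDerivWithin_traceless_le hT hMS ht y).trans ?_
    have := hMt t ht y
    have h4 : (Fintype.card (Fin 3) + 1 : ℝ) = 4 := by norm_num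
    rw [h4]; exact mul_le_mul_of_nonneg_left this (by norm_num)
  have hSc0 : 0 ≤ Sc := by positivity
  have hS₁0 : 0 ≤ S₁ := by positivity
  -- ### Step 5: sizes of the glued stress
  have hRn0 : ∀ t ∈ Icc 0 T, ∀ y, ‖Rn t y‖ ≤ S₀ + (ρ₂ + 2 * (C * S₀)) + D₂ ^ 2 / 2 + K * (Θ₁ * D₂) := by
    intro t ht y
    have h1 := Torus.norm_glueStress_le hns' hold hK ht (hθ01 t).1 (hθ01 t).2 hD₂0 (hdiff t ht) y (R₀ := R') (R₁ := R₁)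
    refine h1.trans ?_
    have a1 := hR0 t ht y; have a2 := hR₁0 t ht y
    have a3 := mul_le_mul_of_nonneg_left (mul_le_mul_of_nonneg_right (hθ' t ht) hD₂0) hK0
    unfold Torus.glueRate; linarith
  have hRnL1 : ∀ t ∈ Icc 0 T, ∫ y, ‖Rn t y‖ ≤ L₁ + (ρ₂ + 2 * (C * L₁)) + D₂ ^ 2 / 2 + K * (Θ₁ * D₂) := by
    intro t ht
    have h1 := Torus.integral_norm_glueStress_le hns' hold hK hRnS ht (hθ01 t).1 (hθ01 t).2 hD₂0 (hdiff t ht) (R₀ := R') (R₁ := R₁)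
    refine h1.trans ?_
    have a1 := hRL1 t ht; have a2 := hR₁L1 t ht
    have a3 := mul_le_mul_of_nonneg_left (mul_le_mul_of_nonneg_right (hθ' t ht) hD₂0) hK0
    unfold Torus.glueRate; linarith
  -- ### Step 6: the `C¹` bounds of the glued stress, zone-wise
  have hRn1 : ∀ t ∈ Icc 0 T, ∀ y l, ‖Torus.partialDeriv l (Rn t) y‖ ≤ Sb₁ + S₁ + D₂ * (C * (W₂ + W₁) + W₁) + K * (Θ₁ * (C * (W₂ + W₁) + W₁)) ∧
      ‖Torus.timeDerivWithin (Icc 0 T) Rn t y‖ ≤ Θ₁ * (S₀ + (ρ₂ + 2 * (C * S₀))) + Sb₂ + S₁ + 2 * Θ₁ * D₂ ^ 2 + D₂ * (C * (W₂ + W₁) + W₂) +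
          K * (Θ₂ * D₂ + Θ₁ * (C * (W₂ + W₁) + W₂)) := by
    intro t ht y l
    have hD1' : 0 ≤ C * (W₂ + W₁) + W₁ := by positivity
    have hDt' : 0 ≤ C * (W₂ + W₁) + W₂ := by positivity
    have h1 := Torus.norm_partialDeriv_glueStress_le_weighted hns' hold hK ht (hθ01 t).1 (hθ01 t).2 l hD₂0 hD1' (hdiff t ht) (fun z => hdiff1 t ht z l) y
      (R₀ := R') (R₁ := R₁)
    have h2 := Torus.norm_timeDerivWithin_glueStress_le_weighted hns' hold hT hθs hK ht (hθ01 t).1 (hθ01 t).2 hD₂0 hDt' (hdiff t ht) (hdifft t ht) y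
      (R₀ := R') (R₁ := R₁)
    simp only [show Torus.glueRate T θ = derivWithin θ (Icc 0 T) from rfl] at h1 h2
    have a3 := hθ' t ht
    have a4 := hθ'' t ht
    have b1 := hR₁1 t ht y l
    have b2 := hR₁t t ht y
    have b3 := hR0 t ht y
    have b4 := hR₁0 t ht y
    have hθ0 := (hθ01 t).1; have hθ1 := (hθ01 t).2
    -- the `R'`-terms: either their weight vanishes (`θ t = 1`) or we are in the quiet zone
    have key : (1 - θ t) * ‖Torus.partialDeriv l (R' t) y‖ ≤ Sb₁ ∧ (1 - θ t) * ‖Torus.timeDerivWithin (Icc 0 T) R' t y‖ ≤ Sb₂ := by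
      by_cases h1θ : θ t = 1
      · rw [h1θ, sub_self, zero_mul, zero_mul]; exact ⟨hSb₁, hSb₂⟩
      · have hlt : Gm t < δ / 4 := hθne1 t h1θ
        -- a relative neighbourhood where `Gm ≤ 3δ/8`
        obtain ⟨r, hr, hball⟩ : ∃ r > 0, ∀ s' ∈ Icc 0 T, |s' - t| < r → Gm s' < 3 * δ / 8 := by
          have hev : ∀ᶠ s' in 𝓝[Icc 0 T] t, Gm s' < 3 * δ / 8 := (hGmc t ht).eventually (gt_mem_nhds (by linarith))
          obtain ⟨u, hu, hsub⟩ := Metric.mem_nhdsWithin_iff.1 hev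
          exact ⟨u, hu, fun s' hs' hd => hsub ⟨by rwa [Metric.mem_ball, Real.dist_eq], hs'⟩⟩
        have hnear : ∀ s' ∈ Icc 0 T, |s' - t| < r → R' s' = Rcb s' := fun s' hs' hd => (hagree s' hs' (hball s' hs' hd).le).2
        have eRt : R' t = Rcb t := hnear t ht (by simpa using hr)
        have eDt : Torus.timeDerivWithin (Icc 0 T) R' t y = Torus.timeDerivWithin (Icc 0 T) Rcb t y := timeDerivWithin_congr_of_ball hr ht hnear y
        obtain ⟨q1, q2⟩ := hquiet t ht (by linarith) y l
        rw [eRt, eDt]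
        have h1mθ : 1 - θ t ≤ 1 := by linarith
        exact ⟨(mul_le_of_le_one_left (norm_nonneg _) h1mθ).trans q1, (mul_le_of_le_one_left (norm_nonneg _) h1mθ).trans q2⟩
    obtain ⟨k1, k2⟩ := key
    have c1 : θ t * ‖Torus.partialDeriv l (R₁ t) y‖ ≤ S₁ := (mul_le_of_le_one_left (norm_nonneg _) hθ1).trans b1
    have c2 : θ t * ‖Torus.timeDerivWithin (Icc 0 T) R₁ t y‖ ≤ S₁ := (mul_le_of_le_one_left (norm_nonneg _) hθ1).trans b2
    constructor
    · refine h1.trans ?_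
      have p1 := mul_le_mul_of_nonneg_left (mul_le_mul_of_nonneg_right a3 hD1') hK0
      linarith
    · refine h2.trans ?_
      have p1 : |derivWithin θ (Icc 0 T) t| * (‖R' t y‖ + ‖R₁ t y‖) ≤ Θ₁ * (S₀ + (ρ₂ + 2 * (C * S₀))) :=
        mul_le_mul a3 (add_le_add b3 b4) (by positivity) hΘ₁0
      have p2 : 2 * |derivWithin θ (Icc 0 T) t| * D₂ ^ 2 ≤ 2 * Θ₁ * D₂ ^ 2 :=
        mul_le_mul_of_nonneg_right (mul_le_mul_of_nonneg_left a3 (by norm_num)) (sq_nonneg _)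
      have p3 : K * (|derivWithin (derivWithin θ (Icc 0 T)) (Icc 0 T) t| * D₂ + |derivWithin θ (Icc 0 T) t| * (C * (W₂ + W₁) + W₂)) ≤
          K * (Θ₂ * D₂ + Θ₁ * (C * (W₂ + W₁) + W₂)) :=
        mul_le_mul_of_nonneg_left (add_le_add (mul_le_mul_of_nonneg_right a4 hD₂0) (mul_le_mul_of_nonneg_right a3 hDt')) hK0
      linarith
  -- ### Step 7: the gaps
  have hGnG' : ∀ t ∈ Icc 0 T, |(e t - ∫ y, ‖vn t y‖ ^ 2) - (e t - ∫ y, ‖v' t y‖ ^ 2)| ≤ η₂ := by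
    intro t ht
    have h1 := abs_integral_norm_sq_sub_le (u := vn t) (v := v' t) (hglue.smooth_velocity.isSmooth_slice ht).continuous
      (hv'S.isSmooth_slice ht).continuous (B := C * W₀) (D := D₂) (fun y => (hv0 t ht y).trans hWCW) (hvnv t ht)
    have e1 : (e t - ∫ y, ‖vn t y‖ ^ 2) - (e t - ∫ y, ‖v' t y‖ ^ 2) = -((∫ y, ‖vn t y‖ ^ 2) - ∫ y, ‖v' t y‖ ^ 2) := by ring
    rw [e1, abs_neg]; exact h1
  -- zone analysis
  have hzones : ∀ t ∈ Icc 0 T, (0 ≤ e t - ∫ y, ‖vn t y‖ ^ 2 ∧ e t - ∫ y, ‖vn t y‖ ^ 2 ≤ δ) ∧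
      (δ / 8 < Gm t → δ / 100 < e t - ∫ y, ‖vn t y‖ ^ 2) := by
    intro t ht
    have g1 := abs_le.1 (hGGm t ht); have g2 := abs_le.1 (hGbGm t ht); have g3 := abs_le.1 (hG'E t ht); have g4 := abs_le.1 (hGnG' t ht)
    have g0 := hGpos t ht
    by_cases hA : Gm t ≤ δ / 8
    · -- untouched zone: `θ = 0`, `v₊ = v' = v`
      have hθ0 : θ t = 0 := by by_contra h; exact absurd (hθne0 t h) (not_lt.2 hA)
      have evn : vn t = v t := by rw [show vn t = v' t from Torus.glueVel_of_eq_zero hθ0]; exact (huntouched t ht hA).1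
      simp only [evn]
      refine ⟨⟨g0, by linarith⟩, fun h => absurd hA (not_le.2 h)⟩
    · have hA' : δ / 8 < Gm t := lt_of_not_ge hA
      by_cases hB : Gm t ≤ 3 * δ / 8
      · -- mixing zone: `v' = v_b`, no pump
        have ev' : (∫ y, ‖v' t y‖ ^ 2) = ∫ y, ‖vb t y‖ ^ 2 := by rw [(hagree t ht hB).1]
        rw [ev'] at g4
        refine ⟨⟨by linarith, by linarith⟩, fun _ => by linarith⟩
      · -- pump zone
        have hB' : 3 * δ / 8 < Gm t := lt_of_not_ge hB
        have hp := sub_pumpProfile_sq_bounds hδ (y := Gm t) (by linarith)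
        have hup : Gm t - pumpProfile δ (Gm t) ^ 2 ≤ δ / 2 := by
          rcases le_or_gt (δ / 2) (Gm t) with h | h
          · rw [hp.2.1 h]; linarith
          · linarith [hp.2.2]
        refine ⟨⟨by linarith [hp.1], by linarith⟩, fun _ => by linarith [hp.1]⟩
  -- ### Assembly
  refine ⟨vn, pn, Rn, D₂, ρ₂, S₁, rfl, rfl, rfl, hglue, hvnmean, hvn0, hvn1, hvnt, hvnv, hRn0, hRnL1,
    fun t ht y l => (hRn1 t ht y l).1, fun t ht y => (hRn1 t ht y 0).2, fun t ht => (hzones t ht).1, fun t ht hsmallgap x => ?_⟩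
  -- (2.6)': a gap `≤ δ/100` forces the untouched zone
  have hA : Gm t ≤ δ / 8 := by
    by_contra h
    have := (hzones t ht).2 (lt_of_not_ge h)
    linarith
  have hθ0 : θ t = 0 := by by_contra h; exact absurd (hθne0 t h) (not_lt.2 hA)
  have hθ'0 := (hθflat t ht (Or.inl hθ0)).1
  have eRn : Rn t = R' t := Torus.glueStress_of_eq_zero hθ0 hθ'0
  rw [eRn, (huntouched t ht hA).2]; rfl

end EnergyPump

end Literature.Analysis.FluidPDE
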